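import Mathlib
import Summits.MatrixMultiplication.MatrixMultiplication.Theses.MatrixPointInterpolation

/-!
# Crux `FewPointMasquerades` (stmt-MatrixMultiplication-18199) — LINE `lagrange-pencil`

Checked skeleton (crux-strategist `planner-cstrat-stmt-MatrixMultiplication-18199-0`, 2026-08-17).
NEW LEVER (not in the route header, the cards, or the registered lines): LAGRANGE INTERPOLATION ALONG
A POLYNOMIAL PENCIL OF PAIRS THROUGH BLOCK-DECOMPOSABLE NODES.

Let `P(z) = Σ_{a ≤ e} z^a G_a ∈ M_n(ℂ)²` be a polynomial curve of pairs of degree `e` with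
`P(0) = G_0 = A`.  For a word `w` with `|w| ≤ 2d` the entries of `w(P(z))` are polynomials in `z` of
degree `≤ 2de`, so for any `m ≥ 2de + 1` distinct nodes `z_s` Lagrange interpolation gives FIXED
weights `λ_s` with `w(A) = w(P(0)) = Σ_s λ_s · w(P(z_s))` for every `|w| ≤ 2d`.  If at every node
the pair `P(z_s)` is `k`-DECOMPOSABLE (`ℂ^n` is an internal direct sum of `P(z_s)`-invariant
subspaces of dimension `≤ k`), then `w(P(z_s))` is a linear function of the word values at the
blocks (pairs of `≤ k × ≤ k` matrices, padded to `k × k`), hence so is `w(A)`: the pair `A` is an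
`N`-point masquerade of size `k` on the window `2d` with `N ≤ m · n` points — and the MASQUERADE
IDENTITIES COME FOR FREE (every identity of `M_k` of degree `≤ 2d` vanishes along the whole pencil).
So the crux follows from

  PENCIL DESIGNS: for every `ε` a `k` such that for arbitrarily large `n` there is a polynomial
  pencil of pairs of degree `e` whose base point generates `M_n` in degree `d` and which passes
  through the `k`-decomposable locus `D_k ⊂ M_n(ℂ)²` at `m ≥ 2de + 1` distinct parameters, with
  `m · n ≤ n^(2+ε)`.

Why easier / what it exposes: the few-point factorisation (a linear-dependence condition over all
`2^(2d+1)` words) is replaced by an INCIDENCE COUNT between a low-degree rational curve and the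
constructible set `D_k` (simultaneous block-diagonalisability, checkable per node by a commutant
computation); witnesses have polynomial-size certificates verifiable by matrix multiplication (no
T-ideal membership), so exact/numerical search applies at small `(n,k,d,e)`; and algebraic families
whose representation theory COLLAPSES to bounded dimension at special parameters (quantum tori /
`U_q` at roots of unity, Azumaya loci of Cayley–Hamilton orders over a curve) are candidate engines.
Necessary conditions already visible: `m ≤ e · D_A` where `D_A` is the least degree of a two-letter
identity of `M_k` failing at `A` (so the base point is a `(k,2d)`-masquerade, consistent), `k ≥ 3`
(`WindowedKaplanskyTwo`), `m ≥ n/k` (point count `N k² ≥ n²`), and at most `e` nodes inside any one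
block-diagonal frame `gΛg⁻¹` (else the curve lies in it), so `≥ 2d + 1` distinct frames occur.

* `stub_pencilDesigns` — the open core (XL).
* `stub_pencilTransfer` — Lagrange + block bookkeeping at fixed data (M/L-sized, classical).
* `FewPointMasquerades_of` — kernel-checked composition (stubs by name, then `PencilDesigns → PencilTransfer → crux`).
-/

set_option linter.dupNamespace false

namespace Summit.MatrixMultiplication.MatrixMultiplication.Cruxes.FewPointMasquerades.LagrangePencil

open scoped BigOperators
open Summit.MatrixMultiplication.MatrixMultiplication.Theses.MatrixPointInterpolation
  (FewPointMasquerades)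

/-! ## Vocabulary -/

/-- `Gen n d A`: the words of length `≤ d` in the pair `A` span `M_n(ℂ)` (literally the generation
conjunct of `FewPointMasquerades`). -/
def Gen (n d : ℕ) (A : Fin 2 → Matrix (Fin n) (Fin n) ℂ) : Prop :=
  Submodule.span ℂ {M : Matrix (Fin n) (Fin n) ℂ |
    ∃ w : List (Fin 2), w.length ≤ d ∧ (w.map A).prod = M} = ⊤

/-- `FewPoint n k d N A B`: evaluation at `A` on the window `2d` factors linearly through the `N`
points `B t ∈ M_k(ℂ)²` (literally the last conjunct of `FewPointMasquerades`). -/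
def FewPoint (n k d N : ℕ) (A : Fin 2 → Matrix (Fin n) (Fin n) ℂ)
    (B : Fin N → Fin 2 → Matrix (Fin k) (Fin k) ℂ) : Prop :=
  ∀ (T : Finset (List (Fin 2))) (c : List (Fin 2) → ℂ), (∀ w ∈ T, w.length ≤ 2 * d) →
    (∀ t : Fin N, (∑ w ∈ T, c w • (w.map (B t)).prod) = 0) → (∑ w ∈ T, c w • (w.map A).prod) = 0

/-- The polynomial pencil of pairs with coefficients `G : Fin (e+1) → M_n(ℂ)²`, evaluated at `z`:
`pencil G z i = Σ_{a ≤ e} z^a • G a i`; its base point is `pencil G 0 = G 0`. -/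
def pencil {n e : ℕ} (G : Fin (e + 1) → Fin 2 → Matrix (Fin n) (Fin n) ℂ) (z : ℂ) :
    Fin 2 → Matrix (Fin n) (Fin n) ℂ :=
  fun i => ∑ a : Fin (e + 1), z ^ (a : ℕ) • G a i

/-- `Decomposable n k P`: the pair `P ∈ M_n(ℂ)²` is `k`-DECOMPOSABLE — `ℂ^n` is the internal direct
sum of finitely many subspaces of dimension `≤ k`, each invariant under both `P 0` and `P 1`
(simultaneous block-diagonalisability with blocks of size `≤ k`). -/
def Decomposable (n k : ℕ) (P : Fin 2 → Matrix (Fin n) (Fin n) ℂ) : Prop :=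
  ∃ (q : ℕ) (V : Fin q → Submodule ℂ (Fin n → ℂ)), DirectSum.IsInternal V ∧
    (∀ j, Module.finrank ℂ (V j) ≤ k) ∧ ∀ (i : Fin 2) (j : Fin q), ∀ v ∈ V j, (P i).mulVec v ∈ V j

/-- **PencilDesigns** (statement of `stub_pencilDesigns`): for every `ε > 0` a block size `k` such
that for every `n₀` there are `n ≥ n₀`, a generation degree `d`, a pencil degree `e`, coefficients
`G` whose base point `G 0` generates `M_n` in degree `d`, and `m ≥ 2de + 1` distinct nodes `z s` at
which the pencil is `k`-decomposable, with `m · n ≤ n^(2+ε)`. -/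
def PencilDesigns : Prop :=
  ∀ ε : ℝ, 0 < ε → ∃ k : ℕ, ∀ n₀ : ℕ, ∃ (n d e m : ℕ)
    (G : Fin (e + 1) → Fin 2 → Matrix (Fin n) (Fin n) ℂ) (z : Fin m → ℂ),
    n₀ ≤ n ∧ ((m * n : ℕ) : ℝ) ≤ (n : ℝ) ^ ((2 : ℝ) + ε) ∧ Gen n d (G 0) ∧
    Function.Injective z ∧ 2 * d * e + 1 ≤ m ∧ ∀ s : Fin m, Decomposable n k (pencil G (z s))

/-- **PencilTransfer** (statement of `stub_pencilTransfer`): a pencil through `m ≥ 2de + 1`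
distinct `k`-decomposable nodes makes its base point an `N`-point masquerade of size `k` on the
window `2d`, `N ≤ m · n` (Lagrange interpolation at `0` + blocks padded to `k × k`). -/
def PencilTransfer : Prop :=
  ∀ (n k d e m : ℕ) (G : Fin (e + 1) → Fin 2 → Matrix (Fin n) (Fin n) ℂ) (z : Fin m → ℂ),
    Function.Injective z → 2 * d * e + 1 ≤ m → (∀ s : Fin m, Decomposable n k (pencil G (z s))) →
    ∃ (N : ℕ) (B : Fin N → Fin 2 → Matrix (Fin k) (Fin k) ℂ), N ≤ m * n ∧ FewPoint n k d N (G 0) B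

/-! ## Registered stubs -/

/-- STUB (open core, XL).  Why plausibly true: nothing forbids a rational curve of low degree from
meeting the constructible set `D_k` (dimension `n² + nk`) in many isolated points — Bézout only bounds
the count by `e · deg`, and one-parameter families whose fibres collapse to bounded representation
type at special parameters are a known phenomenon (roots of unity).  Why it might fail: the naive
incidence count is overdetermined by the factor `≍ d` (each node costs `codim D_k = n² − nk`
conditions against `2n²(e+1)` curve parameters), so witnesses need an identity-driven family, and the
natural ones (quantum torus `(diag(q^j), S)`) have pencil degree `e ≍ n`, too high. -/
theorem stub_pencilDesigns : PencilDesigns := by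
  sorry

/-- STUB (classical, M/L).  Proof on paper: (1) at a node, choose bases of the summands `V j`
(`DirectSum.IsInternal.collectedBasis`), let `B_{s,j} ∈ M_k(ℂ)²` be the matrices of `P(z_s)|_{V j}`
padded by zeros to `k × k`; for a non-commutative polynomial `f` of degree `≤ 2d`, `f(B_{s,j}) = 0`
forces `f(P(z_s)|_{V j}) = 0` (top-left corner) for all `j`, hence `f(P(z_s)) = 0`; (2) the entries
of `f(pencil G z)` are polynomials in `z` of degree `≤ 2de < m` (`Polynomial`, `Matrix.map` of
`Polynomial.eval`), vanishing at the `m` distinct nodes, hence identically, so `f(G 0) = f(P(0)) = 0`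
(`Polynomial.eq_zero_of_natDegree_lt_card_of_eval_eq_zero` / `Lagrange`).  Points: all `B_{s,j}`
with `V j ≠ ⊥`, at most `n` per node. -/
theorem stub_pencilTransfer : PencilTransfer := by
  sorry

/-! ## Composition -/

/-- **The line closes the crux** (single concluding theorem; the two registered stubs enter BY NAME
in the first two lines, the rest is the kernel-checked composition
`PencilDesigns → PencilTransfer → FewPointMasquerades`). -/
theorem FewPointMasquerades_of : FewPointMasquerades := by
  have hD : PencilDesigns := stub_pencilDesigns
  have hT : PencilTransfer := stub_pencilTransfer
  intro ε hε
  obtain ⟨k, hk⟩ := hD ε hε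
  refine ⟨k, fun n₀ => ?_⟩
  obtain ⟨n, d, e, m, G, z, hn, hmn, hgen, hz, hm, hdec⟩ := hk n₀
  obtain ⟨N, B, hN, hB⟩ := hT n k d e m G z hz hm hdec
  refine ⟨n, d, N, G 0, B, hn, ?_, hgen, hB⟩
  calc (N : ℝ) ≤ ((m * n : ℕ) : ℝ) := by exact_mod_cast hN
    _ ≤ (n : ℝ) ^ ((2 : ℝ) + ε) := hmn

end Summit.MatrixMultiplication.MatrixMultiplication.Cruxes.FewPointMasquerades.LagrangePencil
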